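import Mathlib
import Summits.NavierStokesRegularity.OSWSelfSimilar.TypeIIInnerLimitMasterDatum
import HarnessLib
/-!
# (E0) literally: the zoom centres CONVERGE to ONE singular point `x⋆ = (0, 0, z⋆)` on the axis along the master
# subsequence; and in branch (β) the zoomed AZIMUTHAL velocity converges to `Γ_W/r ≠ 0` (zone Z1 TEMPLATE §T1.0 (E0),
# §T1.4-I (I-5)(i)/(C7); kernel, unconditional, any ν > 0)

HONEST FRAMING (cell ns-blowup GROUP B «PROFILE SEARCH», zone Z1; D-0035/D-0074): part XXXVIII of the Z1 dictionary. Part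
XXXV showed that the centres `cₖ` of the gauge N-a zoom stay bounded and that EVERY cluster point is a singular point on
the axis. Passing to one more subsequence makes TEMPLATE (E0)'s «blow-up centre `x*(T) = (0, 0, z*(T))`» literal: the
centres CONVERGE to ONE point `x⋆` with `¬ IsBoundedNearTop u T⋆ x⋆` and `cylRadius x⋆ = 0`, every rider of the master
theorem surviving on the refined subsequence. In branch (β) the centres lie on the axis, so the zoom point `cₖ + λₖy` is
at horizontal distance `λₖ r(y)` from the axis and the physical swirl concentration `ν⁻¹Γ(tₖ + (λₖ²/ν)s, cₖ + λₖy) →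
Γ_W(s, y) ≠ 0` (part XXXI) READS ON THE AZIMUTHAL VELOCITY: `(λₖ/ν) u_θ(tₖ + (λₖ²/ν)s, cₖ + λₖy) → Γ_W(s, y)/r(y) ≠ 0`
— at the core scale the azimuthal velocity is a FIXED FRACTION of the velocity scale `ν/λₖ ≥ sup‖u‖` ((I-5)(i)/(C7) as a
printable kill-form: a type-(β) scenario whose `u_θ/‖u‖_∞` flattens to zero at horizontal distance `O(‖u‖_∞⁻¹)` from the
axis is dead).

* `cylRadius_axisPoint_add_smul`, `smul_swirlVelocity_axisPoint_add_smul` — `r(c + λy) = λ r(y)` for `c` on the axis and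
  `λ u_θ(c + λy) = Γ(c + λy)/r(y)`;
* `zoomed_swirlVelocity_tendsto` — the (β) reading above, from swirl convergence;
* `innerObject_master_of_datum_centreLimit` — part XXXV's master theorem (datum-level hypotheses, any `ν > 0`) with the
  subsequence refined so that `c_{φ k} → x⋆`, `x⋆` a singular point on the axis, and with the azimuthal-velocity rider
  added to branch (β).

**Nothing here asserts that a singular solution exists or that (AX-L) holds or fails.** «violates: n/a — dictionary;
(E0) centre and (C7) core reading by decl»; bears_on LADDER-NS N5/Z1 → N1 linear core / N0⁻. Author:
ns-blowup-profile-eng-1 g9, 2026-08-27.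
-/

open Real Filter Topology Set MeasureTheory Function Bornology Metric
open scoped ENNReal NNReal
open Literature.Analysis.FluidPDE

namespace Summit.NavierStokesRegularity.OSWSelfSimilar
namespace TypeIIModulationDictionary

section CentreLimit

/-- `r(c + λy) = λ r(y)` for `c` on the axis and `λ ≥ 0`. [new here — elementary] -/
theorem cylRadius_axisPoint_add_smul {c : EuclideanSpace ℝ (Fin 3)} (hc0 : c 0 = 0) (hc1 : c 1 = 0) {lam : ℝ}
    (hlam : 0 ≤ lam) (y : EuclideanSpace ℝ (Fin 3)) : cylRadius (c + lam • y) = lam * cylRadius y := by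
  simp only [cylRadius, PiLp.add_apply, PiLp.smul_apply, smul_eq_mul, hc0, hc1, zero_add]
  rw [show (lam * y 0) ^ 2 + (lam * y 1) ^ 2 = lam ^ 2 * (y 0 ^ 2 + y 1 ^ 2) by ring,
    Real.sqrt_mul (sq_nonneg _), Real.sqrt_sq hlam]

/-- **Zoomed azimuthal velocity vs. swirl**: for `c` on the axis, `λ > 0` and `r(y) ≠ 0`,
`λ u_θ(c + λy) = Γ(c + λy)/r(y)` (`Γ = r u_θ` off the axis). [new here — elementary] -/
theorem smul_swirlVelocity_axisPoint_add_smul (f : EuclideanSpace ℝ (Fin 3) → EuclideanSpace ℝ (Fin 3))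
    {c : EuclideanSpace ℝ (Fin 3)} (hc0 : c 0 = 0) (hc1 : c 1 = 0) {lam : ℝ} (hlam : 0 < lam)
    {y : EuclideanSpace ℝ (Fin 3)} (hy : cylRadius y ≠ 0) :
    lam * swirlVelocity f (c + lam • y) = swirl f (c + lam • y) / cylRadius y := by
  have hr : cylRadius (c + lam • y) = lam * cylRadius y := cylRadius_axisPoint_add_smul hc0 hc1 hlam.le y
  have hne : cylRadius (c + lam • y) ≠ 0 := by
    rw [hr]; exact mul_ne_zero hlam.ne' hy
  rw [swirl_eq_cylRadius_mul_swirlVelocity f hne, hr]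
  field_simp

/-- **(I-5)(i)/(C7) ON THE AZIMUTHAL VELOCITY.** If the centres `cₖ` lie on the axis, `λₖ > 0`, and along some clock
`τₖ` the (scaled) swirl converges, `a · Γ(τₖ, cₖ + λₖy) → Γ_W(s)(y) ≠ 0`, then `y` is off the axis and the zoomed azimuthal
velocity converges to a NON-ZERO limit: `a λₖ u_θ(τₖ, cₖ + λₖy) → Γ_W(s)(y)/r(y) ≠ 0`. [new here — elementary] -/
theorem zoomed_swirlVelocity_tendsto {u : ℝ → EuclideanSpace ℝ (Fin 3) → EuclideanSpace ℝ (Fin 3)} {τ lamn : ℕ → ℝ}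
    {cn : ℕ → EuclideanSpace ℝ (Fin 3)} {Ws : EuclideanSpace ℝ (Fin 3) → EuclideanSpace ℝ (Fin 3)} {a : ℝ}
    (hcax : ∀ k, cn k 0 = 0 ∧ cn k 1 = 0) (hlam : ∀ k, 0 < lamn k) {y : EuclideanSpace ℝ (Fin 3)}
    (hsw : Tendsto (fun k => a * swirl (u (τ k)) (cn k + lamn k • y)) atTop (𝓝 (swirl Ws y)))
    (hne : swirl Ws y ≠ 0) :
    cylRadius y ≠ 0 ∧
      Tendsto (fun k => a * (lamn k * swirlVelocity (u (τ k)) (cn k + lamn k • y))) atTop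
        (𝓝 (swirl Ws y / cylRadius y)) ∧ swirl Ws y / cylRadius y ≠ 0 := by
  have hy : cylRadius y ≠ 0 := fun h => hne (swirl_eq_zero_of_cylRadius_eq_zero Ws h)
  refine ⟨hy, ?_, div_ne_zero hne hy⟩
  have h := hsw.div_const (cylRadius y)
  refine h.congr fun k => ?_
  rw [smul_swirlVelocity_axisPoint_add_smul _ (hcax k).1 (hcax k).2 (hlam k) hy]
  ring

variable {T ν Mₛ : ℝ} {u : ℝ → EuclideanSpace ℝ (Fin 3) → EuclideanSpace ℝ (Fin 3)}
  {p : ℝ → EuclideanSpace ℝ (Fin 3) → ℝ}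

/-- **THE MASTER THEOREM WITH A LIMIT CENTRE `x⋆` AND THE AZIMUTHAL-VELOCITY RIDER (datum-level hypotheses; any ν > 0;
unconditional).** As `innerObject_master_of_datum` (part XXXV), and in addition: a point `x⋆` with
`¬ IsBoundedNearTop u T⋆ x⋆` (singular at `T⋆`) and `cylRadius x⋆ = 0` (on the axis) to which the centres CONVERGE along
the subsequence, `c_{φ k} → x⋆` — TEMPLATE (E0)'s blow-up centre `x*(T⋆)`; and in branch (β), at the swirl-concentration
point `(s, y)`: `r(y) ≠ 0` and the zoomed azimuthal velocity `(λₖ/ν) u_θ(tₖ + (λₖ²/ν)s, cₖ + λₖy) → Γ_W(s, y)/r(y) ≠ 0`.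
[new here — dictionary; unconditional] -/
theorem innerObject_master_of_datum_centreLimit (hν : 0 < ν) (hT : 0 < T)
    (hmax : IsMaximalSmoothSolution ν 0 u p T) (hLH : IsLerayHopfOn T ν 0 (u 0) u)
    (hdec : HasRapidSpatialDecay (u 0)) (haxi : IsAxisymmetric (u 0)) (hMₛ : ∀ x, |swirl (u 0) x| ≤ Mₛ) :
    ∃ (tn lamn : ℕ → ℝ) (cn xn : ℕ → EuclideanSpace ℝ (Fin 3)) (φ : ℕ → ℕ)
      (W : ℝ → EuclideanSpace ℝ (Fin 3) → EuclideanSpace ℝ (Fin 3)) (xstar : EuclideanSpace ℝ (Fin 3)),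
      (∀ k, T / 2 ≤ tn k ∧ tn k < T) ∧ Tendsto tn atTop (𝓝 T) ∧ (∀ k, 0 < lamn k) ∧ Tendsto lamn atTop (𝓝 0) ∧
      (∀ k, ∀ t ∈ Icc 0 (tn k), ∀ x, lamn k / ν * ‖u t x‖ ≤ 1) ∧
      Tendsto (fun k => lamn k / ν * ‖u (tn k) (xn k)‖) atTop (𝓝 1) ∧
      (∃ D : ℝ, ∀ k, ‖xn k - cn k‖ ≤ D * lamn k) ∧ (∃ R : ℝ, ∀ k, ‖cn k‖ ≤ R) ∧
      (∀ x₀ : EuclideanSpace ℝ (Fin 3), MapClusterPt x₀ atTop cn → ¬ IsBoundedNearTop u T x₀ ∧ cylRadius x₀ = 0) ∧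
      Tendsto (fun k => cylRadius (cn k)) atTop (𝓝 0) ∧
      ¬ IsBoundedNearTop u T xstar ∧ cylRadius xstar = 0 ∧ Tendsto (fun k => cn (φ k)) atTop (𝓝 xstar) ∧
      StrictMono φ ∧ IsKNSSBlowupLimit W ∧
      (∀ s < 0, TendstoLocallyUniformly
        (fun k => ((lamn (φ k) / ν) • stPull (lamn (φ k) ^ 2 / ν) (lamn (φ k)) (tn (φ k)) (cn (φ k)) u) s)
          (W s) atTop) ∧
      (∀ s t : ℝ, s < t → t < 0 → ∀ x,
        W t x = Literature.Analysis.UnboundedOperators.heatExtension (W s) (t - s) x - oseenDuhamel 1 s W W t x) ∧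
      (∀ s < 0, ∀ y : EuclideanSpace ℝ (Fin 3), Tendsto (fun j => (lamn (φ j) ^ 2 / ν) •
        curl (u (tn (φ j) + lamn (φ j) ^ 2 / ν * s)) (cn (φ j) + lamn (φ j) • y)) atTop (𝓝 (curl (W s) y))) ∧
      (((∃ c : EuclideanSpace ℝ (Fin 3), ‖c‖ = 1 ∧ c 1 = 0 ∧ ∀ s < 0, ∀ y : EuclideanSpace ℝ (Fin 3), W s y = c) ∧
          ∀ s < 0, ∀ y : EuclideanSpace ℝ (Fin 3), Tendsto (fun j => (lamn (φ j) ^ 2 / ν) •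
            curl (u (tn (φ j) + lamn (φ j) ^ 2 / ν * s)) (cn (φ j) + lamn (φ j) • y)) atTop (𝓝 0)) ∨
        ((∀ k, cn k 0 = 0 ∧ cn k 1 = 0) ∧
          ¬ Summit.NavierStokesRegularity.NavierStokesRegularity.AxisymmetricLiouvilleBoundedSwirl ∧
          (∀ s < 0, IsAxisymmetric (W s)) ∧ (∀ s < 0, ∀ y : EuclideanSpace ℝ (Fin 3), |swirl (W s) y| ≤ Mₛ / ν) ∧
          (∃ s < 0, ∃ x : EuclideanSpace ℝ (Fin 3), W s x ≠ W s 0) ∧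
          (∃ s < 0, ∃ y : EuclideanSpace ℝ (Fin 3), curl (W s) y ≠ 0) ∧
          (∃ s < 0, ∃ y : EuclideanSpace ℝ (Fin 3), swirl (W s) y ≠ 0 ∧ cylRadius y ≠ 0 ∧
            Tendsto (fun k => ν⁻¹ * swirl (u (tn (φ k) + lamn (φ k) ^ 2 / ν * s)) (cn (φ k) + lamn (φ k) • y)) atTop
              (𝓝 (swirl (W s) y)) ∧
            Tendsto (fun k => ν⁻¹ * (lamn (φ k) *
              swirlVelocity (u (tn (φ k) + lamn (φ k) ^ 2 / ν * s)) (cn (φ k) + lamn (φ k) • y))) atTop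
              (𝓝 (swirl (W s) y / cylRadius y)) ∧ swirl (W s) y / cylRadius y ≠ 0) ∧
          (∀ C : ℝ, ∃ s < 0, ∃ x : EuclideanSpace ℝ (Fin 3), C < cylRadius x * ‖poloidalPart (W s) x‖) ∧
          (∀ c C : ℝ, ∃ s < 0, ∃ x : EuclideanSpace ℝ (Fin 3), C < cylRadius x * ‖poloidalPart (W s) x - c • eZ‖) ∧
          (∀ q : ℝ≥0∞, 1 ≤ q → q < ⊤ → ∀ K : ℝ≥0, ∃ s < 0, (K : ℝ≥0∞) < eLpNorm (swirl (W s)) q volume) ∧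
          (∃ ε : ℝ, 0 < ε ∧ ∀ R : ℝ, ∃ s < 0, ∃ x : EuclideanSpace ℝ (Fin 3),
            R ≤ cylRadius x ∧ ε < |swirl (W s) x|) ∧
          ∃ ε₀ ∈ Set.Ioo (0 : ℝ) 1, ∀ L R₀ : ℝ, ∃ s < 0, ∃ x : EuclideanSpace ℝ (Fin 3),
            R₀ ≤ cylRadius x ∧ ε₀ * L ^ 2 / cylRadius x < |swirl (W s) x ^ 2 - L ^ 2|)) := by
  obtain ⟨tn, lamn, cn, xn, φ, W, htn, htT, hlam, hlam0, hgauge, hnear, hdist, ⟨R, hR⟩, hclus, -, hcyl, hφ, hW,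
    hconv, hmild, hcurl, halt⟩ := innerObject_master_of_datum hν hT hmax hLH hdec haxi hMₛ
  -- ### one more subsequence: the centres converge
  obtain ⟨xstar, -, ψ, hψ, hlim⟩ := tendsto_subseq_of_bounded (isBounded_closedBall
    (x := (0 : EuclideanSpace ℝ (Fin 3))) (r := R)) (x := cn ∘ φ) fun k => mem_closedBall_zero_iff.2 (hR (φ k))
  have hstar : MapClusterPt xstar atTop cn := (hlim.mapClusterPt).of_comp (hφ.tendsto_atTop.comp hψ.tendsto_atTop)
  obtain ⟨hsing, haxis⟩ := hclus xstar hstar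
  refine ⟨tn, lamn, cn, xn, φ ∘ ψ, W, xstar, htn, htT, hlam, hlam0, hgauge, hnear, hdist, ⟨R, hR⟩, hclus, hcyl, hsing,
    haxis, hlim, hφ.comp hψ, hW, fun s hs => tendstoLocallyUniformly_subseq (hconv s hs) hψ, hmild,
    fun s hs y => (hcurl s hs y).comp hψ.tendsto_atTop, ?_⟩
  rcases halt with ⟨hc, hzero⟩ | ⟨hax0, hnot, hax, hsw, hnc, hcurlne, ⟨s, hs, y, hy, hswirl⟩, hrest⟩
  · exact Or.inl ⟨hc, fun s hs y => (hzero s hs y).comp hψ.tendsto_atTop⟩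
  · have hswirl' : Tendsto (fun k => ν⁻¹ * swirl (u (tn (φ (ψ k)) + lamn (φ (ψ k)) ^ 2 / ν * s))
        (cn (φ (ψ k)) + lamn (φ (ψ k)) • y)) atTop (𝓝 (swirl (W s) y)) := hswirl.comp hψ.tendsto_atTop
    obtain ⟨hry, huθ, hne⟩ := zoomed_swirlVelocity_tendsto (u := u)
      (τ := fun k => tn (φ (ψ k)) + lamn (φ (ψ k)) ^ 2 / ν * s) (lamn := lamn ∘ φ ∘ ψ) (cn := cn ∘ φ ∘ ψ)
      (Ws := W s) (a := ν⁻¹) (fun k => hax0 (φ (ψ k))) (fun k => hlam (φ (ψ k))) (y := y) hswirl' hy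
    exact Or.inr ⟨hax0, hnot, hax, hsw, hnc, hcurlne, ⟨s, hs, y, hy, hry, hswirl', huθ, hne⟩, hrest⟩

end CentreLimit

end TypeIIModulationDictionary
end Summit.NavierStokesRegularity.OSWSelfSimilar
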